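import Mathlib.MeasureTheory.Measure.HasOuterApproxClosed
import Mathlib.MeasureTheory.Measure.Regular
import HarnessLib

/-!
# Route `ColdStartUniversality`, crux K_A1 `UniformColdStartMixing` (stmt-QuantumFields-24809), rung `stub_fixedCutoffMixing`:
# G-block, brick N6 — the order of finite Borel measures is detected by continuous functions

Helper file (seat `ym-line-csu-p1`, g7).  On a space where indicators of closed sets are outer-approximated by bounded
continuous functions (`HasOuterApproxClosed`, e.g. every pseudo-metrizable space) two finite Borel measures with
`∫ f dν ≤ ∫ f dμ` for every continuous `f` with values in `[0,1]` satisfy `ν ≤ μ` (closed sets by the approximating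
sequence, all Borel sets by weak regularity of `ν`).  Used to turn the comparison of expectations
`E f(X^x_t) ≥ c E f(Y^x_t)` (ground-state supersolution argument) into the Doeblin minorisation `Law(X^x_t) ≥ c Law(Y^x_t)`.
No definition, no sorry.  RECORD-rung R3 plumbing; nothing here bears on the mass gap.
-/

set_option autoImplicit false

noncomputable section

namespace Summit.QuantumFields.YangMills.Theorems.ColdStartUniversality

open MeasureTheory Filter BoundedContinuousFunction
open scoped NNReal ENNReal Topology

/-- **Closed sets**: if `∫ f dν ≤ ∫ f dμ` for all continuous `f : Ω → [0,1]`, then `ν F ≤ μ F` for every closed `F`. [folklore] -/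
theorem measure_isClosed_le_of_forall_integral_le {Ω : Type*} [MeasurableSpace Ω] [TopologicalSpace Ω]
    [HasOuterApproxClosed Ω] [OpensMeasurableSpace Ω] {μ ν : Measure Ω} [IsFiniteMeasure μ] [IsFiniteMeasure ν]
    (h : ∀ f : Ω → ℝ, Continuous f → (∀ x, 0 ≤ f x) → (∀ x, f x ≤ 1) → ∫ x, f x ∂ν ≤ ∫ x, f x ∂μ)
    {F : Set Ω} (hF : IsClosed F) : ν F ≤ μ F := by
  have tν := HasOuterApproxClosed.tendsto_lintegral_apprSeq hF ν
  have tμ := HasOuterApproxClosed.tendsto_lintegral_apprSeq hF μ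
  refine le_of_tendsto_of_tendsto' tν tμ fun n => ?_
  have hfin : ∀ (ρ : Measure Ω) [IsFiniteMeasure ρ], ∫⁻ x, (hF.apprSeq n x : ℝ≥0∞) ∂ρ ≠ ⊤ :=
    fun ρ _ => (lintegral_lt_top_of_nnreal ρ (hF.apprSeq n)).ne
  rw [← ENNReal.toReal_le_toReal (hfin ν) (hfin μ), toReal_lintegral_coe_eq_integral,
    toReal_lintegral_coe_eq_integral]
  exact h (fun x => ((hF.apprSeq n x : ℝ≥0) : ℝ)) (NNReal.continuous_coe.comp (hF.apprSeq n).continuous)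
    (fun x => (hF.apprSeq n x).2) (fun x => by exact_mod_cast HasOuterApproxClosed.apprSeq_apply_le_one hF n x)

/-- **The order of finite Borel measures is detected by continuous functions with values in `[0,1]`**:
`(∀ f continuous, 0 ≤ f ≤ 1 → ∫ f dν ≤ ∫ f dμ) → ν ≤ μ` (weak regularity of `ν`). [folklore] -/
theorem measure_le_of_forall_integral_le {Ω : Type*} [MeasurableSpace Ω] [TopologicalSpace Ω]
    [HasOuterApproxClosed Ω] [BorelSpace Ω] {μ ν : Measure Ω} [IsFiniteMeasure μ] [IsFiniteMeasure ν]
    [ν.WeaklyRegular]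
    (h : ∀ f : Ω → ℝ, Continuous f → (∀ x, 0 ≤ f x) → (∀ x, f x ≤ 1) → ∫ x, f x ∂ν ≤ ∫ x, f x ∂μ) :
    ν ≤ μ := by
  rw [Measure.le_iff]
  intro s hs
  rw [hs.measure_eq_iSup_isClosed_of_ne_top (measure_ne_top ν s)]
  exact iSup_le fun F => iSup_le fun hFs => iSup_le fun hF =>
    (measure_isClosed_le_of_forall_integral_le h hF).trans (measure_mono hFs)

/-- Scaled form on a pseudo-metrizable space: `(∀ f continuous, 0 ≤ f ≤ 1 → c ∫ f dν ≤ ∫ f dμ) → (ofReal c) • ν ≤ μ`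
for `0 ≤ c`. [folklore] -/
theorem smul_measure_le_of_forall_integral_le {Ω : Type*} [MeasurableSpace Ω] [TopologicalSpace Ω]
    [TopologicalSpace.PseudoMetrizableSpace Ω] [BorelSpace Ω] {μ ν : Measure Ω} [IsFiniteMeasure μ]
    [IsFiniteMeasure ν] {c : ℝ} (hc : 0 ≤ c)
    (h : ∀ f : Ω → ℝ, Continuous f → (∀ x, 0 ≤ f x) → (∀ x, f x ≤ 1) → c * ∫ x, f x ∂ν ≤ ∫ x, f x ∂μ) :
    (ENNReal.ofReal c) • ν ≤ μ := by
  haveI : IsFiniteMeasure ((ENNReal.ofReal c) • ν) :=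
    ⟨by rw [Measure.smul_apply, smul_eq_mul]; exact ENNReal.mul_lt_top ENNReal.ofReal_lt_top (measure_lt_top _ _)⟩
  refine measure_le_of_forall_integral_le fun f hf h0 h1 => ?_
  rw [integral_smul_measure, ENNReal.toReal_ofReal hc, smul_eq_mul]
  exact h f hf h0 h1

end Summit.QuantumFields.YangMills.Theorems.ColdStartUniversality

end
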